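import Mathlib
import Summits.Ventures.PercRepro2.CoinChainReductionGen
import Summits.Ventures.PercRepro2.CoinChainHeadHyps
import Summits.Ventures.PercRepro2.CoinChainLayerCake

/-!
# Row 2′DARC at the general AND-switch chain under the LAYER-CAKE condition
(blind cell PercRepro2, night-2 g21; proofs/NIGHT2-DARC.md §61)

The general chain of §56.1: `a'` an OR-vertex entered surely from `ent' ⊆ U`, `a` entered surely
from `ent ⊆ U` and from `a'` by the chain coin `c a'` of probability `ρ = pr (c a')`, the free arc
`a → w`, an lsm core `U`, markers `m₁, m₂ ∈ U`.  After the reduction `chain_darc_of_functional`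
the row is the chain functional of `(ν · chainMix ent ent' ρ chainC chainD,
ν · chainMix ent ent' ρ chainC chainD')`, and `chain_functional_nonneg_of_layerCake` proves it
under two numeric conditions on the marker `m₁`: the gate lowers its mean (`hSx`) and the
coin-closed gate `ν · chainMix ent ent' 0 chainC chainD'` has its mean above the chain `R`-mean
(`hG0x`).  Nothing is assumed on `m₂`.  By the symmetry of the row in the two markers the same
theorem with `m₁ ↔ m₂` covers the mirror case.
-/

namespace Summit.Ventures.PercRepro2.Coin

open Classical

section LayerCakeDarc

variable {V : Type*} {E : Type*} [Fintype V] [DecidableEq V] [Fintype E] [DecidableEq E]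
  {R : Type*} [Field R] [LinearOrder R] [IsStrictOrderedRing R]
  {arcs : E → Finset (V × V)} {s : V} {U : Finset V} {ent ent' : Finset V} {c' : V → E}
  {a' a w : V} {c : V → E}

/-- **ROW 2′DARC AT THE GENERAL CHAIN UNDER THE LAYER-CAKE CONDITION**: the gate lowers the mean of
the first marker and the coin-closed gate has the first marker's mean above the chain `R`-mean. -/
theorem darc_of_chain_of_layerCake (pr : E → R) (hp : IsProbVec pr) (hS : SameEnds arcs)
    (h' : OrTailK arcs s U ent' c' a') (hsure' : ∀ r ∈ ent', pr (c' r) = 1)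
    (h : OrTailK arcs s (insert a' U) (insert a' ent) c a) (hsure : ∀ r ∈ ent, pr (c r) = 1)
    (hentU : ent ⊆ U)
    {m₁ m₂ : V} (hm₁ : m₁ ∈ U) (hm₂ : m₂ ∈ U)
    (hν : ∀ W W', W ⊆ U → W' ⊆ U →
      prob pr (coreLevel arcs s U W) * prob pr (coreLevel arcs s U W') ≤
        prob pr (coreLevel arcs s U (W ∩ W')) * prob pr (coreLevel arcs s U (W ∪ W')))
    {t : V} (htC : t ∉ insert a (insert a' U)) (hts : t ≠ s) (hws : w ≠ s)
    (hwC : w ∉ insert a (insert a' U))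
    (hSx : (∑ W ∈ U.powerset, prob pr (coreLevel arcs s U W) *
            chainMix ent ent' (pr (c a')) (chainC pr arcs s t U ent' a' a) (chainD' pr arcs s t U ent' a' a w) W *
            (if m₁ ∈ W then (1 : R) else 0)) *
          (∑ W ∈ U.powerset, prob pr (coreLevel arcs s U W) *
            chainMix ent ent' (pr (c a')) (chainC pr arcs s t U ent' a' a) (chainD pr arcs s t U ent' a' a) W) ≤
        (∑ W ∈ U.powerset, prob pr (coreLevel arcs s U W) *
            chainMix ent ent' (pr (c a')) (chainC pr arcs s t U ent' a' a) (chainD' pr arcs s t U ent' a' a w) W) *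
          (∑ W ∈ U.powerset, prob pr (coreLevel arcs s U W) *
            chainMix ent ent' (pr (c a')) (chainC pr arcs s t U ent' a' a) (chainD pr arcs s t U ent' a' a) W *
            (if m₁ ∈ W then (1 : R) else 0)))
    (hG0x : (∑ W ∈ U.powerset, prob pr (coreLevel arcs s U W) *
            chainMix ent ent' 0 (chainC pr arcs s t U ent' a' a) (chainD' pr arcs s t U ent' a' a w) W) *
          (∑ W ∈ U.powerset, prob pr (coreLevel arcs s U W) *
            chainMix ent ent' (pr (c a')) (chainC pr arcs s t U ent' a' a) (chainD pr arcs s t U ent' a' a) W *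
            (if m₁ ∈ W then (1 : R) else 0)) ≤
        (∑ W ∈ U.powerset, prob pr (coreLevel arcs s U W) *
            chainMix ent ent' 0 (chainC pr arcs s t U ent' a' a) (chainD' pr arcs s t U ent' a' a w) W *
            (if m₁ ∈ W then (1 : R) else 0)) *
          (∑ W ∈ U.powerset, prob pr (coreLevel arcs s U W) *
            chainMix ent ent' (pr (c a')) (chainC pr arcs s t U ent' a' a) (chainD pr arcs s t U ent' a' a) W)) :
    DARC pr arcs s {t} m₁ m₂ a w := by
  obtain ⟨hA0, hAmono, hAlsm⟩ := OrTailU.head_props (U := insert a' U) (a := a) pr hp hS t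
  obtain ⟨hdc, hd'd, hcc, hdd, hd'd', hdd', hratio, hratio', -, hcd, hcd'⟩ :=
    chainPhi_head_hyps (fun X => prob pr (coreAvoidEvent arcs s t (insert a (insert a' U)) X))
      ent' a' a w hA0 hAmono hAlsm
  have hx0 : ∀ W : Finset V, (0 : R) ≤ (if m₁ ∈ W then (1 : R) else 0) := by
    intro W; split_ifs <;> norm_num
  have hy0 : ∀ W : Finset V, (0 : R) ≤ (if m₂ ∈ W then (1 : R) else 0) := by
    intro W; split_ifs <;> norm_num
  have hxm : ∀ s t : Finset V,
      (if m₁ ∈ s then (1 : R) else 0) ≤ (if m₁ ∈ s ∪ t then (1 : R) else 0) := by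
    intro s t
    by_cases h : m₁ ∈ s
    · rw [if_pos h, if_pos (Finset.mem_union_left t h)]
    · rw [if_neg h]; split_ifs <;> norm_num
  have hym : ∀ s t : Finset V,
      (if m₂ ∈ s then (1 : R) else 0) ≤ (if m₂ ∈ s ∪ t then (1 : R) else 0) := by
    intro s t
    by_cases h : m₂ ∈ s
    · rw [if_pos h, if_pos (Finset.mem_union_left t h)]
    · rw [if_neg h]; split_ifs <;> norm_num
  refine chain_darc_of_functional pr hS h' hsure' h hsure hentU hm₁ hm₂ htC hts hws hwC ?_
  exact chain_functional_nonneg_of_layerCake U ent ent' (fun W => prob pr (coreLevel arcs s U W))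
    (chainC pr arcs s t U ent' a' a) (chainD pr arcs s t U ent' a' a) (chainD' pr arcs s t U ent' a' a w)
    (pr (c a')) (hp.nonneg _) (hp.le_one _) (fun W => prob_nonneg hp _)
    (fun s' hs' t' ht' => hν s' t' hs' ht') (fun W => hA0 _) (fun W => hA0 _) (fun W => hA0 _)
    hdc (fun W => le_trans (hd'd W) (hdc W)) hcc hdd hd'd' hcd hcd' hdd' hratio hratio'
    (fun W => if m₁ ∈ W then (1 : R) else 0) (fun W => if m₂ ∈ W then (1 : R) else 0)
    hx0 hy0 hxm hym hSx hG0x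

end LayerCakeDarc

end Summit.Ventures.PercRepro2.Coin
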